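import Literature.NumberTheory.Automorphic.AutomorphicQuotientSpectralExpansionPolar
import Literature.NumberTheory.Automorphic.AdelicCommutativeDatumMultiplicityOne
import HarnessLib

/-!
# The spectral (χ-)expansion of the diagonal trace of a COMMUTATIVE adelic group datum with compact quotient:
# `θ(g ⋆ h^*) = Σ_χ χ(g) · conj χ(h)` over the automorphic characters — the H-side trace identity for a torus

Topic `NumberTheory/Automorphic`; namespace `Literature.NumberTheory.Automorphic` (+ two generic lemmas in `ContRepresentation`).
THEOREMS ONLY (kernel lane): no `def`, no named fact, no instance, no notation, no `sorry`.

For a unitary strongly continuous representation `π` of `G` on a Hilbert space and an EIGENVECTOR `v`, `π(x) v = χ(x) v`: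
* `ContRepresentation.integratedOperator_apply_of_forall_apply_eq_smul` — `π(f) v = (∫ f χ dη) · v` for `f ∈ C_c(G)`;
* `ContRepresentation.inner_integratedOperator_of_forall_apply_eq_smul` — `⟪π(h) v, π(g) v⟫ = conj(∫ h χ) · (∫ g χ) · ⟪v, v⟫`.
For an adelic group datum `𝒢` (★ `AdelicGroupData`) with an automorphic measure `μ`:
* `AdelicGroupData.exists_eigenChar_of_finrank_eq_one` — a vector of a ONE-DIMENSIONAL closed invariant subspace `W ≤ L²` is an
  eigenvector of the right regular representation for some function `χ : G(𝔸_K) → ℂ` (its automorphic character);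
* `AdelicGroupData.tsum_inner_integratedOperator_of_finrank_eq_one` — along a Hilbert basis of such a line indexed by a one-element type the
  block term `Σ_k ⟪R(h) e_k, R(g) e_k⟫` of the polarised χ-expansion (★ `diagTrace_hasSum_tsum_inner_blocks`) is `conj(∫ h χ) · ∫ g χ`.
For a COMMUTATIVE datum (`hcomm : ∀ x y, x * y = y * x`, locally compact, second countable) with COMPACT automorphic quotient — the anisotropic
tori, e.g. the rank-one unitary groups `cmDatum L 1 H` of ★ `AdelicCommutativeDatumMultiplicityOne` and their products, the endoscopic group
`U(1) × U(1)` of a unitary group in two variables [Rogawski1990, §4.6, §11.1] — every irreducible closed constituent of `L²` is a line (★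
`finrank_eq_one_of_isTopIrreducible_of_mul_comm`) occurring once (★ `hasMultiplicityOne_rightRegular_of_mul_comm`), and:
* `AdelicGroupData.exists_unitEigenvectors_of_mul_comm` — an orthogonal decomposition `S` of `L²` into irreducibles carries unit eigenvectors
  `e_W ∈ W` with eigen-functions `χ_W`;
* **`AdelicGroupData.diagTrace_hasSum_inner_of_mul_comm`** — `θ(g ⋆ h^*) = Σ_{W ∈ S} ⟪R(h) e_W, R(g) e_W⟫` for ANY choice of unit vectors
  `e_W ∈ W` (the block form ★ `diagTrace_hasSum_tsum_inner_blocks` with one-element bases);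
* **`AdelicGroupData.diagTrace_hasSum_character_of_mul_comm`** — `θ(g ⋆ h^*) = Σ_{W ∈ S} conj(∫ h χ_W dν) · ∫ g χ_W dν`: the trace of `R(g ⋆ h^*)`
  on `L²(T(K) A_T \ T(𝔸_K))` is the sum over the automorphic characters of `χ(g) conj χ(h)` — the SPECTRAL SIDE OF THE TRACE FORMULA FOR A
  COMPACT-QUOTIENT TORUS, with no multiplicities ([Gelbart1975, (9.11), (10.14)] for `m(π) = 1`, `dim π = 1`; [Rogawski1990, Prop. 11.1.1 (b),
  §11.2: the endoscopic `H = U(1) × U(1)` of `U(2)` contributes `Tr(θ(f^H))` for characters `θ`]).  This is the statement the law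
  `StableSpectralExpansionH` of an `N = 2` comparison kit reads on the H-side when the H-side trace is pinned to ★ `diagTrace`
  (director s454: the `N = 2` edition of the engine T1…T7; HC_CM is proved only modulo the printed citations until rung 0 closes).

## References
* [Gelbart1975] S. Gelbart, *Automorphic forms on adele groups*, Ann. of Math. Stud. 83 (1975), (9.11) p. 144, (10.12)–(10.14) p. 152.
* [Rogawski1990] J. Rogawski, *Automorphic representations of unitary groups in three variables*, Ann. of Math. Stud. 123 (1990), §4.6
  Prop. 4.6.1, §11.1 Prop. 11.1.1 (b), §11.2 p. 162.
* [DeitmarEchterhoff2014] A. Deitmar, S. Echterhoff, *Principles of Harmonic Analysis*, 2nd ed. (2014), Prop. 6.2.1 (the integrated operator),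
  Example 6.1.10 (irreducible unitary representations of abelian groups are characters).
-/

noncomputable section

open MeasureTheory Measure Set Filter Topology CompactlySupported NumberField
open Literature.MeasureTheory.Group Literature.Analysis.OperatorTheory
open ContRepresentation
open scoped ENNReal NNReal InnerProductSpace ComplexConjugate

/-! ## §1 Integrated operators on an eigenvector -/

namespace ContRepresentation

variable {G H : Type*} [Group G] [TopologicalSpace G] [MeasurableSpace G] [OpensMeasurableSpace G]
  [NormedAddCommGroup H] [InnerProductSpace ℂ H] [CompleteSpace H] {π : ContRepresentation ℂ G H}

/-- **`π(f) v = (∫ f χ dη) v` on an eigenvector**: if `π(x) v = χ(x) • v` for all `x`, then for `f ∈ C_c(G)` the integrated operator acts on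
`v` by the scalar `∫ f(x) χ(x) dη(x)` (Bochner integral of `x ↦ (f x χ x) • v`; Mathlib `integral_smul_const`).
[cite: DeitmarEchterhoff2014, Prop. 6.2.1] -/
theorem integratedOperator_apply_of_forall_apply_eq_smul (hu : π.IsUnitary) (hc : π.IsStronglyContinuous) (η : Measure G)
    [IsFiniteMeasureOnCompacts η] (f : C_c(G, ℂ)) {v : H} {χ : G → ℂ} (hχ : ∀ x, π x v = χ x • v) :
    π.integratedOperator hu hc η f v = (∫ x, f x * χ x ∂η) • v := by
  rw [integratedOperator_apply]
  simp_rw [hχ, smul_smul]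
  exact integral_smul_const _ v

/-- **`⟪π(h) v, π(g) v⟫ = conj(∫ h χ) · (∫ g χ) · ⟪v, v⟫` on an eigenvector** (`integratedOperator_apply_of_forall_apply_eq_smul` twice and
`⟪a • v, b • v⟫ = conj a · b · ⟪v, v⟫`). [cite: DeitmarEchterhoff2014, Prop. 6.2.1] -/
theorem inner_integratedOperator_of_forall_apply_eq_smul (hu : π.IsUnitary) (hc : π.IsStronglyContinuous) (η : Measure G)
    [IsFiniteMeasureOnCompacts η] (g h : C_c(G, ℂ)) {v : H} {χ : G → ℂ} (hχ : ∀ x, π x v = χ x • v) :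
    ⟪π.integratedOperator hu hc η h v, π.integratedOperator hu hc η g v⟫_ℂ =
      conj (∫ x, h x * χ x ∂η) * (∫ x, g x * χ x ∂η) * ⟪v, v⟫_ℂ := by
  rw [integratedOperator_apply_of_forall_apply_eq_smul hu hc η h hχ, integratedOperator_apply_of_forall_apply_eq_smul hu hc η g hχ,
    inner_smul_left, inner_smul_right]
  ring

end ContRepresentation

namespace Literature.NumberTheory.Automorphic

namespace AdelicGroupData

universe u

variable {K : Type} [Field K] [NumberField K] (𝒢 : AdelicGroupData.{u} K)
  (μ : Measure 𝒢.automorphicQuotient) [𝒢.IsAutomorphicMeasure μ]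

/-! ## §2 Lines in `L²`: eigen-functions and their block terms -/

/-- **A one-dimensional closed invariant subspace of `L²` consists of eigenvectors**: if `dim_ℂ W = 1` and `v ∈ W`, there is a function
`χ : G(𝔸_K) → ℂ` with `R(x) v = χ(x) v` for all `x` (`R(x) v ∈ W = ℂ v`; for `v ≠ 0` `χ` is the automorphic character carried by `W`, for `v = 0`
any `χ` works). [cite: DeitmarEchterhoff2014, Example 6.1.10] -/
theorem exists_eigenChar_of_finrank_eq_one (W : ContRepresentation.ClosedSubrep (𝒢.rightRegular μ))
    (hW : Module.finrank ℂ W.toSubmodule = 1) {v : 𝒢.L2 μ} (hv : v ∈ W) :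
    ∃ χ : 𝒢.Adelic → ℂ, ∀ x, 𝒢.rightRegular μ x v = χ x • v := by
  by_cases hv0 : v = 0
  · exact ⟨fun _ => 0, fun x => by rw [hv0, map_zero, smul_zero]⟩
  · have hv0' : (⟨v, hv⟩ : W.toSubmodule) ≠ 0 := fun h => hv0 (congrArg Subtype.val h)
    have hgen := (finrank_eq_one_iff_of_nonzero' (⟨v, hv⟩ : W.toSubmodule) hv0').1 hW
    have hex : ∀ x, ∃ c : ℂ, c • v = 𝒢.rightRegular μ x v := fun x => by
      obtain ⟨c, hc⟩ := hgen ⟨𝒢.rightRegular μ x v, W.apply_mem x hv⟩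
      exact ⟨c, congrArg Subtype.val hc⟩
    choose χ hχ using hex
    exact ⟨χ, fun x => (hχ x).symm⟩

/-- **The block term of a line is `conj(∫ h χ) · ∫ g χ`**: for a closed invariant `W ≤ L²`, a Hilbert basis `b` of `W` indexed by a type with
exactly one element whose vector `e = b k₀` satisfies `R(x) e = χ(x) e`, `Σ_k ⟪R(h) e_k, R(g) e_k⟫ = conj(∫ h χ dν) · ∫ g χ dν` (`‖e‖ = 1`).
[cite: Gelbart1975, (10.14)] -/
theorem tsum_inner_integratedOperator_of_forall_apply_eq_smul [MeasurableSpace 𝒢.Adelic] [BorelSpace 𝒢.Adelic] (ν : Measure 𝒢.Adelic)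
    [IsFiniteMeasureOnCompacts ν]
    (W : ContRepresentation.ClosedSubrep (𝒢.rightRegular μ)) {κ : Type*} [Unique κ]
    (b : HilbertBasis κ ℂ W.toSubmodule) {χ : 𝒢.Adelic → ℂ} (hχ : ∀ x, 𝒢.rightRegular μ x (b default : 𝒢.L2 μ) = χ x • (b default : 𝒢.L2 μ))
    (g h : C_c(𝒢.Adelic, ℂ)) :
    ∑' k, ⟪(𝒢.rightRegular μ).integratedOperator (𝒢.isUnitary_rightRegular μ) (𝒢.isStronglyContinuous_rightRegular_holds μ) ν h (b k),
        (𝒢.rightRegular μ).integratedOperator (𝒢.isUnitary_rightRegular μ) (𝒢.isStronglyContinuous_rightRegular_holds μ) ν g (b k)⟫_ℂ =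
      conj (∫ x, h x * χ x ∂ν) * ∫ x, g x * χ x ∂ν := by
  rw [tsum_eq_single default (fun k hk => absurd (Unique.eq_default k) hk),
    ContRepresentation.inner_integratedOperator_of_forall_apply_eq_smul _ _ ν g h hχ]
  have h1 : ‖(b default : 𝒢.L2 μ)‖ = 1 := by rw [Submodule.norm_coe]; exact b.orthonormal.norm_eq_one default
  have h1' : ⟪(b default : 𝒢.L2 μ), (b default : 𝒢.L2 μ)⟫_ℂ = 1 := by
    rw [inner_self_eq_norm_sq_to_K, h1]; simp
  rw [h1', mul_one]

variable [LocallyCompactSpace 𝒢.Adelic] [SecondCountableTopology 𝒢.Adelic] [T2Space 𝒢.Adelic]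
  [MeasurableSpace 𝒢.Adelic] [BorelSpace 𝒢.Adelic]
  [hH : IsClosed (𝒢.quotientSubgroup : Set 𝒢.Adelic)]
  (ρ : Measure 𝒢.quotientSubgroup) [ρ.IsMulLeftInvariant] [ρ.IsMulRightInvariant] [ρ.IsInvInvariant]
  [IsFiniteMeasureOnCompacts ρ] [SFinite ρ]
  (ν : Measure 𝒢.Adelic) [IsHaarMeasure ν] [ν.IsInvInvariant]

/-! ## §3 Commutative data with compact quotient: `θ(g ⋆ h^*) = Σ_χ χ(g) conj χ(h)` -/

omit [LocallyCompactSpace 𝒢.Adelic] [SecondCountableTopology 𝒢.Adelic] [T2Space 𝒢.Adelic] [MeasurableSpace 𝒢.Adelic]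
  [BorelSpace 𝒢.Adelic] hH in
/-- **Unit eigenvectors of an orthogonal decomposition (commutative datum).**  If `G(𝔸_K)` is commutative, every topologically irreducible closed
invariant `W ≤ L²` is a line (★ `finrank_eq_one_of_isTopIrreducible_of_mul_comm`), hence contains a unit vector `e_W`, an eigenvector of `R`:
`R(x) e_W = χ_W(x) e_W`. [cite: DeitmarEchterhoff2014, Example 6.1.10] -/
theorem exists_unitEigenvectors_of_mul_comm (hcomm : ∀ x y : 𝒢.Adelic, x * y = y * x)
    {S : Set (ContRepresentation.ClosedSubrep (𝒢.rightRegular μ))} (hirr : ∀ W ∈ S, W.toContRep.IsTopIrreducible) :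
    ∃ (e : S → 𝒢.L2 μ) (χ : S → 𝒢.Adelic → ℂ),
      (∀ W : S, e W ∈ (W : ContRepresentation.ClosedSubrep (𝒢.rightRegular μ))) ∧ (∀ W : S, ‖e W‖ = 1) ∧
        ∀ (W : S) x, 𝒢.rightRegular μ x (e W) = χ W x • e W := by
  have hline : ∀ W : S, Module.finrank ℂ (W : ContRepresentation.ClosedSubrep (𝒢.rightRegular μ)).toSubmodule = 1 := fun W =>
    𝒢.finrank_eq_one_of_isTopIrreducible_of_mul_comm μ hcomm W.1 (hirr W.1 W.2)
  have hex : ∀ W : S, ∃ e : 𝒢.L2 μ, e ∈ (W : ContRepresentation.ClosedSubrep (𝒢.rightRegular μ)) ∧ ‖e‖ = 1 := by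
    intro W
    haveI : Nontrivial (W : ContRepresentation.ClosedSubrep (𝒢.rightRegular μ)).toSubmodule :=
      Module.nontrivial_of_finrank_eq_succ (hline W)
    obtain ⟨w, hw⟩ := exists_ne (0 : (W : ContRepresentation.ClosedSubrep (𝒢.rightRegular μ)).toSubmodule)
    have hw' : (w : 𝒢.L2 μ) ≠ 0 := fun h => hw (Subtype.ext h)
    refine ⟨(‖(w : 𝒢.L2 μ)‖⁻¹ : ℂ) • (w : 𝒢.L2 μ), ?_, ?_⟩
    · exact (W : ContRepresentation.ClosedSubrep (𝒢.rightRegular μ)).toSubmodule.smul_mem _ w.2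
    · rw [norm_smul, norm_inv, Complex.norm_real, norm_norm, inv_mul_cancel₀ (norm_ne_zero_iff.mpr hw')]
  choose e he he1 using hex
  have hχ : ∀ W : S, ∃ χ : 𝒢.Adelic → ℂ, ∀ x, 𝒢.rightRegular μ x (e W) = χ x • e W := fun W =>
    𝒢.exists_eigenChar_of_finrank_eq_one μ W.1 (hline W) (he W)
  choose χ hχ using hχ
  exact ⟨e, χ, he, he1, hχ⟩

omit [LocallyCompactSpace 𝒢.Adelic] [SecondCountableTopology 𝒢.Adelic] [T2Space 𝒢.Adelic] [MeasurableSpace 𝒢.Adelic]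
  [BorelSpace 𝒢.Adelic] hH in
/-- A unit vector of a line `W ≤ L²` (commutative datum, `W` irreducible) IS a Hilbert basis of `W` indexed by `Unit`: some Hilbert basis `b`
of `W` has `b () = e`. [cite: DeitmarEchterhoff2014, Example 6.1.10] -/
theorem exists_hilbertBasis_unit_of_mul_comm (hcomm : ∀ x y : 𝒢.Adelic, x * y = y * x)
    (W : ContRepresentation.ClosedSubrep (𝒢.rightRegular μ)) (hW : W.toContRep.IsTopIrreducible)
    {e : 𝒢.L2 μ} (he : e ∈ W) (he1 : ‖e‖ = 1) :
    ∃ b : HilbertBasis Unit ℂ W.toSubmodule, (b () : 𝒢.L2 μ) = e := by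
  have hline := 𝒢.finrank_eq_one_of_isTopIrreducible_of_mul_comm μ hcomm W hW
  let v : Unit → W.toSubmodule := fun _ => ⟨e, he⟩
  have hv : Orthonormal ℂ v := by
    refine ⟨fun _ => by change ‖e‖ = 1; exact he1, fun i j hij => absurd (Subsingleton.elim i j) hij⟩
  have he0 : (⟨e, he⟩ : W.toSubmodule) ≠ 0 := by
    intro h
    have : ‖e‖ = 0 := by rw [show e = ((⟨e, he⟩ : W.toSubmodule) : 𝒢.L2 μ) from rfl, h]; simp
    rw [he1] at this
    exact one_ne_zero this
  have hspan : ∀ z : W.toSubmodule, (∀ i, ⟪v i, z⟫_ℂ = 0) → z = 0 := by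
    intro z hz
    obtain ⟨c, hc⟩ := (finrank_eq_one_iff_of_nonzero' (⟨e, he⟩ : W.toSubmodule) he0).1 hline z
    have h0 := hz ()
    rw [← hc, inner_smul_right] at h0
    rcases mul_eq_zero.1 h0 with h | h
    · rw [← hc, h, zero_smul]
    · exact absurd (inner_self_eq_zero.1 h) he0
  exact ⟨HilbertBasis.mkOfOrthogonalEqBot hv (by
      rw [Submodule.eq_bot_iff]
      intro z hz
      refine hspan z fun i => ?_
      rw [Submodule.mem_orthogonal'] at hz
      simpa [inner_eq_zero_symm] using hz (v i) (Submodule.subset_span ⟨i, rfl⟩)),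
    by rw [HilbertBasis.coe_mkOfOrthogonalEqBot]⟩

/-- **The χ-expansion of a commutative datum, vector form**: `G(𝔸_K)` commutative, locally compact, second countable; compact automorphic
quotient; `μ` automorphic; `S` an orthogonal decomposition of `L²(X, μ)` into irreducible closed invariant subspaces with dense span; `e_W ∈ W` ANY
unit vectors.  Then for `g, h ∈ C_c(G(𝔸_K))` and `F = g ⋆ h^*`: **`θ(F) = Σ_{W ∈ S} ⟪R(h) e_W, R(g) e_W⟫`** (convergent series) — ★
`diagTrace_hasSum_tsum_inner_blocks` with the one-element bases `{e_W}` (`exists_hilbertBasis_unit_of_mul_comm`). [cite: Gelbart1975, (10.12)–(10.14)]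
[cite: Rogawski1990, Prop. 11.1.1 (b)] -/
theorem diagTrace_hasSum_inner_of_mul_comm [CompactSpace 𝒢.automorphicQuotient] (hρ : ρ ≠ 0)
    (hcomm : ∀ x y : 𝒢.Adelic, x * y = y * x)
    (g h F : C_c(𝒢.Adelic, ℂ)) (hF : ∀ x, F x = mulConv ν (⇑g) (mulStar (⇑h)) x)
    {S : Set (ContRepresentation.ClosedSubrep (𝒢.rightRegular μ))} (hirr : ∀ W ∈ S, W.toContRep.IsTopIrreducible)
    (horth : S.Pairwise fun W W' => W.toSubmodule ⟂ W'.toSubmodule) (hdense : ContRepresentation.ClosedSubrep.iSupClosure S = ⊤)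
    (e : S → 𝒢.L2 μ) (he : ∀ W : S, e W ∈ (W : ContRepresentation.ClosedSubrep (𝒢.rightRegular μ))) (he1 : ∀ W : S, ‖e W‖ = 1) :
    HasSum (fun W : S => ⟪(𝒢.rightRegular μ).integratedOperator (𝒢.isUnitary_rightRegular μ)
        (𝒢.isStronglyContinuous_rightRegular_holds μ) ν h (e W),
      (𝒢.rightRegular μ).integratedOperator (𝒢.isUnitary_rightRegular μ)
        (𝒢.isStronglyContinuous_rightRegular_holds μ) ν g (e W)⟫_ℂ) (𝒢.diagTrace μ ρ ν F) := by
  have hb : ∀ W : S, ∃ b : HilbertBasis Unit ℂ (W : ContRepresentation.ClosedSubrep (𝒢.rightRegular μ)).toSubmodule,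
      (b () : 𝒢.L2 μ) = e W := fun W =>
    𝒢.exists_hilbertBasis_unit_of_mul_comm μ hcomm W.1 (hirr W.1 W.2) (he W) (he1 W)
  choose b hb using hb
  have h0 := 𝒢.diagTrace_hasSum_tsum_inner_blocks μ ρ ν hρ g h F hF horth hdense b
  refine h0.congr_fun fun W => ?_
  rw [tsum_eq_single () (fun k hk => absurd (Subsingleton.elim k ()) hk), hb W]

/-- **The χ-expansion of a commutative datum, character form — the spectral side of the trace formula of a compact-quotient torus**: with the
data of `diagTrace_hasSum_inner_of_mul_comm` and the eigen-functions `χ_W` of the unit vectors `e_W` (`R(x) e_W = χ_W(x) e_W`, which exist by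
`exists_unitEigenvectors_of_mul_comm`): **`θ(g ⋆ h^*) = Σ_{W ∈ S} conj(∫ h χ_W dν) · ∫ g χ_W dν`** — every automorphic character occurring in
`L²` contributes `χ(g) · conj χ(h)` exactly once (multiplicity one, ★ `hasMultiplicityOne_rightRegular_of_mul_comm`; distinct members of `S` carry
distinct characters, ★ `eq_of_areUnitarilyEquivalent_of_mul_comm`).  For the endoscopic torus `U(1) × U(1)` of a unitary group in two variables this
is «`Tr θ(f^H)` summed over the characters `θ` of `H`» [Rogawski1990, Prop. 11.1.1 (b), §11.2]. [cite: Gelbart1975, (9.11) and (10.14)]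
[cite: Rogawski1990, Prop. 11.1.1 (b); §11.2 p. 162] -/
theorem diagTrace_hasSum_character_of_mul_comm [CompactSpace 𝒢.automorphicQuotient] (hρ : ρ ≠ 0)
    (hcomm : ∀ x y : 𝒢.Adelic, x * y = y * x)
    (g h F : C_c(𝒢.Adelic, ℂ)) (hF : ∀ x, F x = mulConv ν (⇑g) (mulStar (⇑h)) x)
    {S : Set (ContRepresentation.ClosedSubrep (𝒢.rightRegular μ))} (hirr : ∀ W ∈ S, W.toContRep.IsTopIrreducible)
    (horth : S.Pairwise fun W W' => W.toSubmodule ⟂ W'.toSubmodule) (hdense : ContRepresentation.ClosedSubrep.iSupClosure S = ⊤)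
    (e : S → 𝒢.L2 μ) (he : ∀ W : S, e W ∈ (W : ContRepresentation.ClosedSubrep (𝒢.rightRegular μ))) (he1 : ∀ W : S, ‖e W‖ = 1)
    (χ : S → 𝒢.Adelic → ℂ) (hχ : ∀ (W : S) x, 𝒢.rightRegular μ x (e W) = χ W x • e W) :
    HasSum (fun W : S => conj (∫ x, h x * χ W x ∂ν) * ∫ x, g x * χ W x ∂ν) (𝒢.diagTrace μ ρ ν F) := by
  refine (𝒢.diagTrace_hasSum_inner_of_mul_comm μ ρ ν hρ hcomm g h F hF hirr horth hdense e he he1).congr_fun fun W => ?_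
  have h1' : ⟪e W, e W⟫_ℂ = 1 := by rw [inner_self_eq_norm_sq_to_K, he1 W]; simp
  rw [ContRepresentation.inner_integratedOperator_of_forall_apply_eq_smul _ _ ν g h (hχ W), h1', mul_one]

/-- **Existence form** (no data to supply): for a commutative datum with compact quotient and an orthogonal decomposition `S` of `L²` into
irreducibles with dense span, THERE ARE eigen-functions `χ_W` (`W ∈ S`) of unit vectors of the lines `W` with
`θ(g ⋆ h^*) = Σ_{W ∈ S} conj(∫ h χ_W dν) · ∫ g χ_W dν`. [cite: Gelbart1975, (9.11) and (10.14)] [cite: Rogawski1990, Prop. 11.1.1 (b); §11.2 p. 162] -/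
theorem exists_diagTrace_hasSum_character_of_mul_comm [CompactSpace 𝒢.automorphicQuotient] (hρ : ρ ≠ 0)
    (hcomm : ∀ x y : 𝒢.Adelic, x * y = y * x)
    {S : Set (ContRepresentation.ClosedSubrep (𝒢.rightRegular μ))} (hirr : ∀ W ∈ S, W.toContRep.IsTopIrreducible)
    (horth : S.Pairwise fun W W' => W.toSubmodule ⟂ W'.toSubmodule) (hdense : ContRepresentation.ClosedSubrep.iSupClosure S = ⊤) :
    ∃ (e : S → 𝒢.L2 μ) (χ : S → 𝒢.Adelic → ℂ),
      (∀ W : S, e W ∈ (W : ContRepresentation.ClosedSubrep (𝒢.rightRegular μ))) ∧ (∀ W : S, ‖e W‖ = 1) ∧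
      (∀ (W : S) x, 𝒢.rightRegular μ x (e W) = χ W x • e W) ∧
      ∀ (g h F : C_c(𝒢.Adelic, ℂ)), (∀ x, F x = mulConv ν (⇑g) (mulStar (⇑h)) x) →
        HasSum (fun W : S => conj (∫ x, h x * χ W x ∂ν) * ∫ x, g x * χ W x ∂ν) (𝒢.diagTrace μ ρ ν F) := by
  obtain ⟨e, χ, he, he1, hχ⟩ := 𝒢.exists_unitEigenvectors_of_mul_comm μ hcomm hirr
  exact ⟨e, χ, he, he1, hχ, fun g h F hF => 𝒢.diagTrace_hasSum_character_of_mul_comm μ ρ ν hρ hcomm g h F hF hirr horth hdense e he he1 χ hχ⟩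

end AdelicGroupData

end Literature.NumberTheory.Automorphic

end
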